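/-
Copyright (c) 2026 the pub-hodgecm-mathlib formalisation cell (harness21).  Prover seat hodgecm-mathlib-F0P3a-p04 (g30), carve (c8) of SIG-F3-5 v1 (LH7-p04 (g11), pen now
LH10-p01 (g10) by (β)), heir LEAD F0P3a-plan (g16) T14-66 ∕ T15-08, 2026-09-03.
-/
import Literature.NumberTheory.Automorphic.TypeTwoSelfDualCyclicParityUniform   -- ★ the F4 gate `exists_selfDual_cyclic_iff_even_log_uniform` (its binder currency is the target of this file)
import HarnessLib

/-!
# The F4 gate's eigen-data at a unitary generator of a glued over-order (carve (c8), field side)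

Topic `NumberTheory/Automorphic`; namespace `Literature.NumberTheory.Automorphic.SymmetricEigenframe` (the gate's).  THEOREMS ONLY (valuation algebra in the ramified quadratic
eigen-field; no definition, no instance, no notation, no named fact, no `sorry`); count-neutral; kernel lane `--supports stmt-HodgeConjecture-24833`.  Cell `pub/hodgecm-mathlib`
(D-0151), crux H413; road M6, route (B) «TOT-Λ by over-orders», SIG-F3-5 v1 6925585c (S5) «GOODNESS ⟺ hermitian ∧ Lvl ∧ parity»; design memo
`F0/P3a/F0P3a-p04/g30/f35/C8-gate-at-generator.v1.F0P3ap04g30.md` bca68c90 §2 (the lemma L8).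

THE SITUATION.  ★ (UG) `exists_unitary_generator_glued` produces, for a good glued over-order `G(N″, b, c′) ⊂ 𝒪_E × 𝒪_K` (`K ∕ E` the ramified quadratic eigen-field, `j : E → K`,
`ι` its involution, Eisenstein generator `Θ` of `𝒪_K`: `Θ + ιΘ, Θ·ιΘ ∈ j(𝔪_E)`, so `|Θ| < 1`, `ιΘ ≠ Θ`), a deep unitary generator `x′ = (u′, λ′)`, `λ′ = j p′ + j q′·Θ`, with
`λ′² − j t′·λ′ + j D′ = 0`, `u′ ≡ p′ ≡ 1`, `|q′| = q^{−N″}`, `|u′² − t′u′ + D′| = q^{−b}`.  The ★ F4 gate at `τ′ := φ′ x′` wants, besides the matrix-side binders ((c5-i) LH10-p01: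
block charpoly, unitarity, the `x₀`-eigenline), the EIGEN-DATA `hlamO hlam1 hne hquad` of `λ′` and the two exponents `hexpn : |j u′ − λ′| = exp(−n)`, `hexpN : |λ′ − ιλ′| = …`.
THIS FILE: `|λ′| ≤ 1`, `|λ′ − 1| < 1`, `ιλ′ ≠ λ′`; VIETA `λ′ + ιλ′ = j t′`, `λ′·ιλ′ = j D′` (two distinct roots); the LEVEL EXPONENT **`|j u′ − λ′|_K = |u′² − t′u′ + D′|_E`**
(`N_{K∕E}(ju′ − λ′) = u′² − t′u′ + D′`, `|ι z| = |z|`, `|j x| = |x|²`) — so the gate's `n` IS the glue depth `b`, and the parity read at `τ′` is `Even (log|ᵗσ(x₀)Jx₀| + b)`, frame-free;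
and the DIFFERENT identity **`|λ′ − ιλ′|_K = |q′|_E² · |Θ − ιΘ|_K`** — the only frame-dependent datum (uniformiser frame: `|Θ − ιΘ| = exp(−(2e+1))`, `e = ord_E 2`, giving the gate's
`N := N″ + e`; W-unit frame: ★ p852848's defect `k`), memo §3.  [cite: Rogawski1990, §4.9 Lemma 4.9.3 p. 56] [cite: SerreLocalFields1979, Ch. I §6 Prop. 17–18; Ch. III §6 Cor. 2]
HONEST LABEL: count-neutral; zero label movement until F5 ★ + a desk-priced rider; HC_CM is proved only modulo the 7 printed citations (2 remaining named inputs: hLiu418 =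
stmt-HodgeConjecture-24832, h413 = stmt-HodgeConjecture-24833) until rung 0 closes.

## References
* [Rogawski1990] J. D. Rogawski, *Automorphic Representations of Unitary Groups in Three Variables*, Ann. of Math. Stud. 123 (1990): §4.9 Lemma 4.9.3 p. 56, Prop. 4.9.1 (b) p. 55.
* [SerreLocalFields1979] J.-P. Serre, *Local Fields*, GTM 67 (1979): Ch. I §6 Prop. 17–18 (Eisenstein equations, monogenic `𝒪_K`), Ch. III §6 Cor. 2 (the different of a monogenic
  order is `(f′(Θ))`), Ch. II §2 (extension of the valuation: `|j x|_K = |x|_E^e`).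
-/

set_option autoImplicit false

open scoped WithZero

namespace Literature.NumberTheory.Automorphic.SymmetricEigenframe

variable {E K : Type*} [Field E] [Valued E ℤᵐ⁰] [Field K] [Valued K ℤᵐ⁰]

/-! ## §1 The eigenvalue `λ′ = j p′ + j q′·Θ`: integral, deep, not `ι`-fixed -/

/-- `|j p′ + j q′·Θ| ≤ 1` for `|p′|, |q′| ≤ 1`, `|Θ| ≤ 1` (`|j x| = |x|²`). [cite: SerreLocalFields1979, Ch. II §2] -/
theorem v_generator_le_one (j : E →+* K) (hjv : ∀ x, Valued.v (j x) = Valued.v x ^ 2) {Θ : K} (hΘ : Valued.v Θ ≤ 1)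
    {p' q' : E} (hp : Valued.v p' ≤ 1) (hq : Valued.v q' ≤ 1) : Valued.v (j p' + j q' * Θ) ≤ 1 := by
  refine le_trans (Valuation.map_add _ _ _) (max_le ?_ ?_)
  · rw [hjv]; exact pow_le_one₀ zero_le hp
  · rw [Valuation.map_mul, hjv]; exact mul_le_one' (pow_le_one₀ zero_le hq) hΘ

/-- DEPTH: `|j p′ + j q′·Θ − 1| < 1` when `|p′ − 1| < 1`, `|q′| ≤ 1` and `|Θ| < 1` (the Eisenstein generator is a non-unit). [cite: SerreLocalFields1979, Ch. I §6 Prop. 17–18] -/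
theorem v_generator_sub_one_lt_one (j : E →+* K) (hjv : ∀ x, Valued.v (j x) = Valued.v x ^ 2) {Θ : K} (hΘ : Valued.v Θ < 1)
    {p' q' : E} (hp1 : Valued.v (p' - 1) < 1) (hq : Valued.v q' ≤ 1) : Valued.v (j p' + j q' * Θ - 1) < 1 := by
  rw [show j p' + j q' * Θ - 1 = j (p' - 1) + j q' * Θ by rw [map_sub, map_one]; ring]
  refine lt_of_le_of_lt (Valuation.map_add _ _ _) (max_lt ?_ ?_)
  · rw [hjv]; exact pow_lt_one₀ zero_le hp1 two_ne_zero
  · rw [Valuation.map_mul, hjv]; exact mul_lt_one_of_nonneg_of_lt_one_right (pow_le_one₀ zero_le hq) zero_le hΘ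

omit [Valued E ℤᵐ⁰] [Valued K ℤᵐ⁰] in
/-- `ι(j p′ + j q′·Θ) ≠ j p′ + j q′·Θ` as soon as `q′ ≠ 0` and `ιΘ ≠ Θ` (`ι ∘ j = j`). [cite: SerreLocalFields1979, Ch. I §6 Prop. 17–18] -/
theorem iota_generator_ne (j : E →+* K) (ι : K →+* K) (hιj : ∀ x, ι (j x) = j x) {Θ : K} (hιΘ : ι Θ ≠ Θ)
    {p' q' : E} (hq0 : q' ≠ 0) : ι (j p' + j q' * Θ) ≠ j p' + j q' * Θ := by
  intro h
  rw [map_add, map_mul, hιj, hιj, add_right_inj] at h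
  exact hιΘ (mul_left_cancel₀ ((map_ne_zero j).2 hq0) h)

/-! ## §2 Vieta for the two roots `λ′`, `ιλ′` of `X² − j t′·X + j D′` -/

omit [Valued E ℤᵐ⁰] [Valued K ℤᵐ⁰] in
/-- If `λ² − j t·λ + j D = 0` and `ιλ ≠ λ` (`ι` a ring endomorphism fixing `j(E)`), then `λ + ιλ = j t`. [cite: SerreLocalFields1979, Ch. I §6 Prop. 17–18] -/
theorem add_iota_eq_of_quad (j : E →+* K) (ι : K →+* K) (hιj : ∀ x, ι (j x) = j x) {lam : K} {t D : E}
    (hquad : lam ^ 2 - j t * lam + j D = 0) (hne : ι lam ≠ lam) : lam + ι lam = j t := by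
  have h2 : (ι lam) ^ 2 - j t * ι lam + j D = 0 := by
    have h := congrArg ι hquad
    rwa [map_add, map_sub, map_pow, map_mul, hιj, hιj, map_zero] at h
  have hprod : (lam - ι lam) * (lam + ι lam - j t) = 0 := by linear_combination hquad - h2
  rcases mul_eq_zero.1 hprod with h0 | h0
  · exact absurd (sub_eq_zero.1 h0).symm hne
  · exact sub_eq_zero.1 h0

omit [Valued E ℤᵐ⁰] [Valued K ℤᵐ⁰] in
/-- … and then `λ·ιλ = j D`. [cite: SerreLocalFields1979, Ch. I §6 Prop. 17–18] -/
theorem mul_iota_eq_of_quad (j : E →+* K) (ι : K →+* K) (hιj : ∀ x, ι (j x) = j x) {lam : K} {t D : E}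
    (hquad : lam ^ 2 - j t * lam + j D = 0) (hne : ι lam ≠ lam) : lam * ι lam = j D := by
  have hs := add_iota_eq_of_quad j ι hιj hquad hne
  rw [show ι lam = j t - lam by rw [← hs]; ring]
  linear_combination -hquad

omit [Valued E ℤᵐ⁰] [Valued K ℤᵐ⁰] in
/-- THE NORM IDENTITY `(j u − λ)(j u − ιλ) = j(u² − t·u + D)`. [cite: SerreLocalFields1979, Ch. I §6 Prop. 17–18] -/
theorem norm_j_sub_eq_of_quad (j : E →+* K) (ι : K →+* K) (hιj : ∀ x, ι (j x) = j x) {lam : K} {t D : E}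
    (hquad : lam ^ 2 - j t * lam + j D = 0) (hne : ι lam ≠ lam) (u : E) :
    (j u - lam) * (j u - ι lam) = j (u * u - t * u + D) := by
  have hs := add_iota_eq_of_quad j ι hιj hquad hne
  have hp := mul_iota_eq_of_quad j ι hιj hquad hne
  rw [map_add, map_sub, map_mul, map_mul, ← hp, show j t = lam + ι lam from hs.symm]
  ring

/-! ## §3 The two exponents of the gate at the generator -/

/-- **THE LEVEL EXPONENT IS THE GLUE DEPTH**: `|j u′ − λ′|_K = |u′² − t′u′ + D′|_E` for `λ′` a root of `X² − j t′X + j D′` with `ιλ′ ≠ λ′`, `ι` isometric and fixing `j(E)`, and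
`|j x|_K = |x|_E²` (ramified quadratic).  With ★ (UG) (iii) `|u′² − t′u′ + D′| = q^{−b}` this is the gate's `hexpn` at `n := b`.
[cite: Rogawski1990, §4.9 Lemma 4.9.3 p. 56] [cite: SerreLocalFields1979, Ch. II §2; Ch. I §6 Prop. 17–18] -/
theorem v_j_sub_generator_eq (j : E →+* K) (hjv : ∀ x, Valued.v (j x) = Valued.v x ^ 2) (ι : K →+* K) (hιj : ∀ x, ι (j x) = j x)
    (hιv : ∀ y, Valued.v (ι y) = Valued.v y) {lam : K} {t D : E}
    (hquad : lam ^ 2 - j t * lam + j D = 0) (hne : ι lam ≠ lam) (u : E) :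
    Valued.v (j u - lam) = Valued.v (u * u - t * u + D) := by
  have h := congrArg Valued.v (norm_j_sub_eq_of_quad j ι hιj hquad hne u)
  rw [Valuation.map_mul, show j u - ι lam = ι (j u - lam) by rw [map_sub, hιj], hιv, hjv, ← sq] at h
  exact (pow_left_inj₀ zero_le zero_le two_ne_zero).1 h

/-- The level exponent in the gate's letters: `|u′² − t′u′ + D′|_E = exp(−b) ⇒ |j u′ − λ′|_K = exp(−b)`. [cite: Rogawski1990, §4.9 Lemma 4.9.3 p. 56] -/
theorem v_j_sub_generator_eq_exp (j : E →+* K) (hjv : ∀ x, Valued.v (j x) = Valued.v x ^ 2) (ι : K →+* K) (hιj : ∀ x, ι (j x) = j x)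
    (hιv : ∀ y, Valued.v (ι y) = Valued.v y) {lam : K} {t D : E}
    (hquad : lam ^ 2 - j t * lam + j D = 0) (hne : ι lam ≠ lam) {u : E} {b : ℕ}
    (hb : Valued.v (u * u - t * u + D) = WithZero.exp (-(b : ℤ))) :
    Valued.v (j u - lam) = WithZero.exp (-(b : ℤ)) := by
  rw [v_j_sub_generator_eq j hjv ι hιj hιv hquad hne u, hb]

/-- **THE DIFFERENT IDENTITY**: `|λ′ − ιλ′|_K = |q′|_E² · |Θ − ιΘ|_K` for `λ′ = j p′ + j q′·Θ` — the conductor exponent of the gate (`hexpN`) is `2·ord q′` plus the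
(frame-dependent) valuation of `Θ − ιΘ`, a generator of the different of the monogenic `𝒪_K = 𝒪_E[Θ]`. [cite: SerreLocalFields1979, Ch. III §6 Cor. 2; Ch. II §2] -/
theorem v_generator_sub_iota_eq (j : E →+* K) (hjv : ∀ x, Valued.v (j x) = Valued.v x ^ 2) (ι : K →+* K) (hιj : ∀ x, ι (j x) = j x)
    (Θ : K) (p' q' : E) :
    Valued.v ((j p' + j q' * Θ) - ι (j p' + j q' * Θ)) = Valued.v q' ^ 2 * Valued.v (Θ - ι Θ) := by
  rw [show (j p' + j q' * Θ) - ι (j p' + j q' * Θ) = j q' * (Θ - ι Θ) by rw [map_add, map_mul, hιj, hιj]; ring,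
    Valuation.map_mul, hjv]

/-- The conductor exponent in the gate's letters, UNIFORMISER∕W-ODD frame: `|q′| = exp(−N″)` and `|Θ − ιΘ| = exp(−(2s+1))` give `|λ′ − ιλ′| = exp(−(2(N″+s)+1))` — the
gate's `hexpN` with `N := N″ + s` (`s = 0` tame, `s = ord_E 2` on the W-odd rows). [cite: SerreLocalFields1979, Ch. III §6 Cor. 2] [cite: Rogawski1990, §4.9 Lemma 4.9.3 p. 56] -/
theorem v_generator_sub_iota_eq_exp (j : E →+* K) (hjv : ∀ x, Valued.v (j x) = Valued.v x ^ 2) (ι : K →+* K) (hιj : ∀ x, ι (j x) = j x)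
    {Θ : K} {s : ℕ} (hΘ : Valued.v (Θ - ι Θ) = WithZero.exp (-((2 * s + 1 : ℕ) : ℤ)))
    {p' q' : E} {N'' : ℕ} (hq : Valued.v q' = WithZero.exp (-(N'' : ℤ))) :
    Valued.v ((j p' + j q' * Θ) - ι (j p' + j q' * Θ)) = WithZero.exp (-((2 * (N'' + s) + 1 : ℕ) : ℤ)) := by
  rw [v_generator_sub_iota_eq j hjv ι hιj, hq, hΘ, ← WithZero.exp_nsmul, ← WithZero.exp_add]
  congr 1
  push_cast
  ring

end Literature.NumberTheory.Automorphic.SymmetricEigenframe
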